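import Literature.MathematicalPhysics.QuantumLattice.HubbardModel
import Literature.MathematicalPhysics.QuantumLattice.HubbardRectangularTorus
import Literature.MathematicalPhysics.QuantumLattice.HubbardBootstrapCertificate
import Literature.MathematicalPhysics.QuantumLattice.HubbardBootstrapCertificateResidual
import Literature.MathematicalPhysics.QuantumLattice.HeisenbergModel
import Literature.MathematicalPhysics.QuantumLattice.HubbardSpinChargeCertificate
import Literature.MathematicalPhysics.QuantumLattice.SectorGroundState
import Literature.MathematicalPhysics.QuantumLattice.HubbardTorusLocalCertificate
import Literature.MathematicalPhysics.QuantumLattice.HubbardTorus2DEnergyDensity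
import Literature.MathematicalPhysics.QuantumLattice.HubbardWindowCertificateD4
import Literature.MathematicalPhysics.QuantumLattice.HubbardCorrelatorCertificate
import Literature.MathematicalPhysics.QuantumLattice.HubbardCorrelatorCertificateAffine
import Literature.MathematicalPhysics.QuantumLattice.HubbardChainDoubleOccupancyLiebWu
import Literature.MathematicalPhysics.QuantumLattice.HubbardKineticEnergyDensity
import Literature.MathematicalPhysics.QuantumLattice.HeisenbergWindowCertificateSquare
import Literature.MathematicalPhysics.QuantumLattice.HubbardTorusLimitSpinCorrelationSign
import Literature.MathematicalPhysics.QuantumLattice.HubbardTorusChargeGapSpinGap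
import Literature.MathematicalPhysics.QuantumLattice.HubbardSzSectorMonotone
import Literature.MathematicalPhysics.QuantumLattice.HubbardHalfFilledSectorOrdering
import Literature.MathematicalPhysics.QuantumLattice.HubbardRingPerronFrobeniusProofs
import Literature.MathematicalPhysics.QuantumLattice.HubbardSectorCorrelatorCertificate
import Literature.MathematicalPhysics.QuantumLattice.HubbardOddSectorReduction
import Summits.HubbardSuperconductivity.HubbardLadder.HubbardMomentRows
import Summits.HubbardSuperconductivity.HubbardLadder.Bounds.TorusRayleighUpperRows
import HarnessLib
import HarnessLib.Audit
import Summits.HubbardSuperconductivity.ManyBodyBootstrap.Bounds.Defs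
import Summits.HubbardSuperconductivity.ManyBodyBootstrap.Bounds.EDTorusRows
import Summits.HubbardSuperconductivity.ManyBodyBootstrap.Bounds.SdpRows1
import Summits.HubbardSuperconductivity.ManyBodyBootstrap.Bounds.SdpRows2
import Summits.HubbardSuperconductivity.ManyBodyBootstrap.Bounds.SdpRows3
import Summits.HubbardSuperconductivity.ManyBodyBootstrap.Bounds.SdpRows4
import Summits.HubbardSuperconductivity.ManyBodyBootstrap.Bounds.SdpRows5
import Summits.HubbardSuperconductivity.ManyBodyBootstrap.Bounds.Corollaries1
import Summits.HubbardSuperconductivity.ManyBodyBootstrap.Bounds.Corollaries2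
import Summits.HubbardSuperconductivity.ManyBodyBootstrap.Bounds.Corollaries3
import Summits.HubbardSuperconductivity.ManyBodyBootstrap.Bounds.Corollaries4
import Summits.HubbardSuperconductivity.ManyBodyBootstrap.Bounds.Corollaries5
import Summits.HubbardSuperconductivity.ManyBodyBootstrap.Bounds.Corollaries6
import Summits.HubbardSuperconductivity.ManyBodyBootstrap.Bounds.OneHoleUpperRows
import Summits.HubbardSuperconductivity.ManyBodyBootstrap.Bounds.SdpRows6
import Summits.HubbardSuperconductivity.ManyBodyBootstrap.Bounds.Corollaries7
import Summits.HubbardSuperconductivity.ManyBodyBootstrap.Bounds.SdpRows7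
import Summits.HubbardSuperconductivity.ManyBodyBootstrap.Bounds.Corollaries8
import Summits.HubbardSuperconductivity.ManyBodyBootstrap.Bounds.Corollaries8
import Summits.HubbardSuperconductivity.ManyBodyBootstrap.Bounds.Defs
import Summits.HubbardSuperconductivity.ManyBodyBootstrap.Bounds.SdpRows7
import Summits.HubbardSuperconductivity.ManyBodyBootstrap.Bounds.SdpRows8

/-!
# Many-body bootstrap — Bounds: kernel-checked corollaries (new trailer; see section banners)

Part `Corollaries9` (2/2) of the cell's staged module `HubbardCertifiedBoundsNext.lean` (sha256 `44ebb62547ba1de4…`), filed under the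
cell topic `ManyBodyBootstrap` (lit seat pub-mbboot, tool `file_parts_g19.py`; unit→part table in HOME/PLACEMENT.md).
Declarations are the staged ones, byte-identical up to: namespace `Summit.HubbardSuperconductivity.Bounds` → `Summit.HubbardSuperconductivity.ManyBodyBootstrap.Bounds`,
`@[conjecture]` on every certificate CLAIM NODE (`def … : Prop`, an open obligation node closable in-kernel from the
certificate's exact data — NOT a vendored fact) and a closing `[computation: <format>, exact ℚ]` tag in its docstring.
Scope, provenance, certificate formats, verifiers and the PROVED soundness theorems are stated in the module docstring of
part `Defs` and in each row's docstring. HONEST FRAMING: certified numerical bounds on a lattice model; not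
superconductivity, not a phase diagram.
-/

noncomputable section

namespace Summit.HubbardSuperconductivity.ManyBodyBootstrap.Bounds

open Literature.MathematicalPhysics.QuantumLattice
open Summit.HubbardSuperconductivity.HubbardLadder (stagStructureFour)
open Summit.HubbardSuperconductivity.HubbardLadder (localMomentFour re_expect_localMomentFour)
open Summit.HubbardSuperconductivity.HubbardLadder.Bounds (torusUpper_mbbootE2_4x4_U8_N16 groundEnergyAt_rect_4x4_U8_N16_le_of_claim torusUpper_mbbootE2_4x4_U4_N16 groundEnergyAt_rect_4x4_U4_N16_le_of_claim)
open Summit.HubbardSuperconductivity.HubbardLadder.Bounds (torusUpper_mbbootE2_4x4_U2_N16 groundEnergyAt_rect_4x4_U2_N16_le_of_claim torusUpper_mbbootE2_4x4_U12_N16 groundEnergyAt_rect_4x4_U12_N16_le_of_claim)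
open Summit.HubbardSuperconductivity.HubbardLadder.Bounds (torusUpper_mbbootE2_4x4_U6_N16 groundEnergyAt_rect_4x4_U6_N16_le_of_claim)
open Literature.Probability.LatticeModels
open Filter Topology HubbardWave0 Literature.MathematicalPhysics.QuantumManyBody.StateRelaxation
open scoped Matrix

/-! ## part Corollaries9 -/
/-! ## gen-129: sector-correlator corollaries of the half-filled `4×4` torus at `U = 12` (closing E-7 rows)
Rows `sdp_corr_sector_hub_torus4x4_U12_N16_b4eom_{Dlo,Dup,Slo,AFlo,AFup}` (certsdp 0.4.3, kit j098951/j098952/j098954/j098962/j098963; index rows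
151–156) together with the `Sup` row 147 of `SdpRows7` (GENERATED by pub-mbboot-typer/g129/mk_trailer_g129.py from certs/sdp1/index.json,
exact ℚ computed in-script, decimals rounded OUTWARD). Also the `U = 6` Slo row 156 (kit j098936) with the Sup row 141 of `SdpRows7`: `spinNN_4x4_U6_ceiling` / `spinNN_4x4_U12_ceiling` (Corollaries8) are superseded by the two-sided brackets below.
Every theorem assumes the rows' hypothesis `E₀(16) ≤ u` with `u` = E2's certified Rayleigh upper (tree claim node
`torusUpper_mbbootE2_4x4_U<U>_N16`), exactly as trailer_g124/g125/g128 did at `U = 2, 4, 6, 8`. Zero admits. -/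

section Gen129SectorCorrelatorsU6U12

/-- **Two-sided bracket on the nearest-neighbour spin correlation of the `4×4`, `U = 6`, half-filled ground state** from the rows
`sdp_corr_sector_hub_torus4x4_U6_N16_b4eom_S{lo,up}` (kit j098936, j098937) only: for every unit `16`-particle ground vector `ψ` of
`hamiltonian (fermionTorusGraph 2 4) 1 6`, given `E₀(16) ≤ u = -725141255523/68719476736` (E2's certified Rayleigh upper), the ORDERED-adjacent-pair operator
`𝓑 = Σ_{x ~ y} 𝐒_x·𝐒_y` (64 ordered pairs = `2·Σ_bonds`, `fermionSpinDot_comm`) has `⟨𝓑⟩ ∈ [-18.4667023, -8.515392]` (exact `[-11162436564964206662576505/604462909807314587353088, -2573619339216274664249189/302231454903657293676544]`),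
i.e. the per-bond correlation `C₁ = ⟨𝓑⟩/64 ∈ [-0.2885423, -0.133053]` (decimals rounded outward); in particular `C₁ < 0` (antiferromagnetic on average). Zero admits. -/
theorem spinNN_4x4_U6_bracket
    (lo : sdp_corr_sector_hub_torus4x4_U6_N16_b4eom_Slo) (up : sdp_corr_sector_hub_torus4x4_U6_N16_b4eom_Sup)
    (hu : E₀ 4 4 1 6 16 ≤ -725141255523/68719476736)
    {ψ : Fock (Orb (FermionTorus 2 4))} (hψ : IsGroundState (hamiltonian (fermionTorusGraph 2 4) 1 6) 16 ψ)
    (hψ1 : star ψ ⬝ᵥ ψ = 1) :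
    (-18.4667023 : ℝ) ≤ (expect (∑ x : FermionTorus 2 4, ∑ y : FermionTorus 2 4, if (fermionTorusGraph 2 4).Adj x y then fermionSpinDot x y else 0) ψ).re ∧
    (expect (∑ x : FermionTorus 2 4, ∑ y : FermionTorus 2 4, if (fermionTorusGraph 2 4).Adj x y then fermionSpinDot x y else 0) ψ).re ≤ -8.515392 ∧
    (-0.2885423 : ℝ) ≤ (expect (∑ x : FermionTorus 2 4, ∑ y : FermionTorus 2 4, if (fermionTorusGraph 2 4).Adj x y then fermionSpinDot x y else 0) ψ).re / 64 ∧
    (expect (∑ x : FermionTorus 2 4, ∑ y : FermionTorus 2 4, if (fermionTorusGraph 2 4).Adj x y then fermionSpinDot x y else 0) ψ).re / 64 ≤ -0.133053 := by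
  have hu' : groundEnergyAt (fermionTorusGraph 2 4) 1 6 16 ≤ ((-725141255523/68719476736 : ℚ) : ℝ) := by
    rw [groundEnergyAt_fermionTorusGraph_two]; push_cast; simpa [E₀] using hu
  have hH : hamiltonian (fermionTorusGraph 2 4) 1 6 *ᵥ ψ =
      ((groundEnergyAt (fermionTorusGraph 2 4) 1 6 16 : ℝ) : ℂ) • ψ := hψ.2.2
  have h1 := lo hu' ψ hψ.1 hψ1 hH
  have h2 := up hu' ψ hψ.1 hψ1 hH
  rw [Matrix.smul_mulVec, dotProduct_smul] at h1 h2
  push_cast at h1 h2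
  simp only [one_smul, neg_smul, Complex.neg_re] at h1 h2
  unfold expect
  refine ⟨?_, ?_, ?_, ?_⟩ <;> linarith

/-- `spinNN_4x4_U6_bracket` (per-bond part) with the hypothesis taken as the claim node `torusUpper_mbbootE2_4x4_U6_N16`. Zero admits. -/
theorem spinNN_4x4_U6_bracket_of_claim
    (lo : sdp_corr_sector_hub_torus4x4_U6_N16_b4eom_Slo) (up : sdp_corr_sector_hub_torus4x4_U6_N16_b4eom_Sup)
    (h : torusUpper_mbbootE2_4x4_U6_N16)
    {ψ : Fock (Orb (FermionTorus 2 4))} (hψ : IsGroundState (hamiltonian (fermionTorusGraph 2 4) 1 6) 16 ψ)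
    (hψ1 : star ψ ⬝ᵥ ψ = 1) :
    (-0.2885423 : ℝ) ≤ (expect (∑ x : FermionTorus 2 4, ∑ y : FermionTorus 2 4, if (fermionTorusGraph 2 4).Adj x y then fermionSpinDot x y else 0) ψ).re / 64 ∧
    (expect (∑ x : FermionTorus 2 4, ∑ y : FermionTorus 2 4, if (fermionTorusGraph 2 4).Adj x y then fermionSpinDot x y else 0) ψ).re / 64 ≤ -0.133053 :=
  (spinNN_4x4_U6_bracket lo up
  (by have := groundEnergyAt_rect_4x4_U6_N16_le_of_claim h; unfold E₀; push_cast; linarith) hψ hψ1).2.2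

/-- **Two-sided bracket on the double occupancy of the `4×4`, `U = 12`, half-filled ground state** from the rows
`sdp_corr_sector_hub_torus4x4_U12_N16_b4eom_D{lo,up}` (kit j098951, j098952) only: for every unit `16`-particle ground vector `ψ` of
`hamiltonian (fermionTorusGraph 2 4) 1 12`, given the rows' hypothesis `E₀(16) ≤ u = -205889822849/34359738368` (E2's certified Rayleigh upper,
stated on `E₀ 4 4 1 12 16`; transferred by `groundEnergyAt_fermionTorusGraph_two`), `N_D = ⟨Σ_x n_{x↑}n_{x↓}⟩ ∈ [0.4090715, 0.6410556]`
(exact `[494537103265553271037271/1208925819614629174706176, 48436787546036061832273/75557863725914323419136]`) and `d = N_D/16 ∈ [0.0255669, 0.040066]` (decimals rounded outward; `expect A ψ = ⟨ψ, Aψ⟩`). Zero admits. -/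
theorem doubleOcc_4x4_U12_bracket
    (lo : sdp_corr_sector_hub_torus4x4_U12_N16_b4eom_Dlo) (up : sdp_corr_sector_hub_torus4x4_U12_N16_b4eom_Dup)
    (hu : E₀ 4 4 1 12 16 ≤ -205889822849/34359738368)
    {ψ : Fock (Orb (FermionTorus 2 4))} (hψ : IsGroundState (hamiltonian (fermionTorusGraph 2 4) 1 12) 16 ψ)
    (hψ1 : star ψ ⬝ᵥ ψ = 1) :
    (0.4090715 : ℝ) ≤ (expect (∑ x : FermionTorus 2 4, numberOp x 0 * numberOp x 1) ψ).re ∧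
    (expect (∑ x : FermionTorus 2 4, numberOp x 0 * numberOp x 1) ψ).re ≤ 0.6410556 ∧
    (0.0255669 : ℝ) ≤ (expect (∑ x : FermionTorus 2 4, numberOp x 0 * numberOp x 1) ψ).re / 16 ∧
    (expect (∑ x : FermionTorus 2 4, numberOp x 0 * numberOp x 1) ψ).re / 16 ≤ 0.040066 := by
  have hu' : groundEnergyAt (fermionTorusGraph 2 4) 1 12 16 ≤ ((-205889822849/34359738368 : ℚ) : ℝ) := by
    rw [groundEnergyAt_fermionTorusGraph_two]; push_cast; simpa [E₀] using hu
  have hH : hamiltonian (fermionTorusGraph 2 4) 1 12 *ᵥ ψ =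
      ((groundEnergyAt (fermionTorusGraph 2 4) 1 12 16 : ℝ) : ℂ) • ψ := hψ.2.2
  have h1 := lo hu' ψ hψ.1 hψ1 hH
  have h2 := up hu' ψ hψ.1 hψ1 hH
  rw [Matrix.smul_mulVec, dotProduct_smul] at h1 h2
  push_cast at h1 h2
  simp only [one_smul, neg_smul, Complex.neg_re] at h1 h2
  unfold expect
  refine ⟨?_, ?_, ?_, ?_⟩ <;> linarith

/-- **Local moment of the `4×4`, `U = 12`, half-filled ground state**: `m_loc = ⟨M⟩/16 = 1 − 2d ∈ [0.919868, 0.9488661]`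
(`M = localMomentFour`; kernel identity `re_expect_localMomentFour`, HubbardMomentRows.lean), from `doubleOcc_4x4_U12_bracket`.
Comparison: pub-hubbard has no `U = 12` local-moment row (HubbardRowsExactHyp.lean stops at U = 8); this is the first certified bracket at U = 12. Zero admits. -/
theorem localMoment_4x4_U12_bracket
    (lo : sdp_corr_sector_hub_torus4x4_U12_N16_b4eom_Dlo) (up : sdp_corr_sector_hub_torus4x4_U12_N16_b4eom_Dup)
    (hu : E₀ 4 4 1 12 16 ≤ -205889822849/34359738368)
    {ψ : Fock (Orb (FermionTorus 2 4))} (hψ : IsGroundState (hamiltonian (fermionTorusGraph 2 4) 1 12) 16 ψ)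
    (hψ1 : star ψ ⬝ᵥ ψ = 1) :
    (0.919868 : ℝ) ≤ (expect localMomentFour ψ).re / 16 ∧ (expect localMomentFour ψ).re / 16 ≤ 0.9488661 := by
  obtain ⟨h1, h2, -, -⟩ := doubleOcc_4x4_U12_bracket lo up hu hψ hψ1
  rw [re_expect_localMomentFour hψ.1 hψ1]
  push_cast
  constructor <;> linarith

/-- `doubleOcc_4x4_U12_bracket` (per-site part) with the hypothesis taken as the claim node `torusUpper_mbbootE2_4x4_U12_N16`. Zero admits. -/
theorem doubleOcc_4x4_U12_bracket_of_claim
    (lo : sdp_corr_sector_hub_torus4x4_U12_N16_b4eom_Dlo) (up : sdp_corr_sector_hub_torus4x4_U12_N16_b4eom_Dup)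
    (h : torusUpper_mbbootE2_4x4_U12_N16)
    {ψ : Fock (Orb (FermionTorus 2 4))} (hψ : IsGroundState (hamiltonian (fermionTorusGraph 2 4) 1 12) 16 ψ)
    (hψ1 : star ψ ⬝ᵥ ψ = 1) :
    (0.0255669 : ℝ) ≤ (expect (∑ x : FermionTorus 2 4, numberOp x 0 * numberOp x 1) ψ).re / 16 ∧
    (expect (∑ x : FermionTorus 2 4, numberOp x 0 * numberOp x 1) ψ).re / 16 ≤ 0.040066 :=
  (doubleOcc_4x4_U12_bracket lo up
  (by have := groundEnergyAt_rect_4x4_U12_N16_le_of_claim h; unfold E₀; push_cast; linarith) hψ hψ1).2.2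

/-- **Two-sided bracket on the nearest-neighbour spin correlation of the `4×4`, `U = 12`, half-filled ground state** from the rows
`sdp_corr_sector_hub_torus4x4_U12_N16_b4eom_S{lo,up}` (kit j098954, j098958) only: for every unit `16`-particle ground vector `ψ` of
`hamiltonian (fermionTorusGraph 2 4) 1 12`, given `E₀(16) ≤ u = -205889822849/34359738368` (E2's certified Rayleigh upper), the ORDERED-adjacent-pair operator
`𝓑 = Σ_{x ~ y} 𝐒_x·𝐒_y` (64 ordered pairs = `2·Σ_bonds`, `fermionSpinDot_comm`) has `⟨𝓑⟩ ∈ [-21.4287258, -14.8539439]` (exact `[-12952869893084278389070543/604462909807314587353088, -2244664540679434043077599/151115727451828646838272]`),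
i.e. the per-bond correlation `C₁ = ⟨𝓑⟩/64 ∈ [-0.3348239, -0.2320928]` (decimals rounded outward); in particular `C₁ < 0` (antiferromagnetic on average). Zero admits. -/
theorem spinNN_4x4_U12_bracket
    (lo : sdp_corr_sector_hub_torus4x4_U12_N16_b4eom_Slo) (up : sdp_corr_sector_hub_torus4x4_U12_N16_b4eom_Sup)
    (hu : E₀ 4 4 1 12 16 ≤ -205889822849/34359738368)
    {ψ : Fock (Orb (FermionTorus 2 4))} (hψ : IsGroundState (hamiltonian (fermionTorusGraph 2 4) 1 12) 16 ψ)
    (hψ1 : star ψ ⬝ᵥ ψ = 1) :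
    (-21.4287258 : ℝ) ≤ (expect (∑ x : FermionTorus 2 4, ∑ y : FermionTorus 2 4, if (fermionTorusGraph 2 4).Adj x y then fermionSpinDot x y else 0) ψ).re ∧
    (expect (∑ x : FermionTorus 2 4, ∑ y : FermionTorus 2 4, if (fermionTorusGraph 2 4).Adj x y then fermionSpinDot x y else 0) ψ).re ≤ -14.8539439 ∧
    (-0.3348239 : ℝ) ≤ (expect (∑ x : FermionTorus 2 4, ∑ y : FermionTorus 2 4, if (fermionTorusGraph 2 4).Adj x y then fermionSpinDot x y else 0) ψ).re / 64 ∧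
    (expect (∑ x : FermionTorus 2 4, ∑ y : FermionTorus 2 4, if (fermionTorusGraph 2 4).Adj x y then fermionSpinDot x y else 0) ψ).re / 64 ≤ -0.2320928 := by
  have hu' : groundEnergyAt (fermionTorusGraph 2 4) 1 12 16 ≤ ((-205889822849/34359738368 : ℚ) : ℝ) := by
    rw [groundEnergyAt_fermionTorusGraph_two]; push_cast; simpa [E₀] using hu
  have hH : hamiltonian (fermionTorusGraph 2 4) 1 12 *ᵥ ψ =
      ((groundEnergyAt (fermionTorusGraph 2 4) 1 12 16 : ℝ) : ℂ) • ψ := hψ.2.2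
  have h1 := lo hu' ψ hψ.1 hψ1 hH
  have h2 := up hu' ψ hψ.1 hψ1 hH
  rw [Matrix.smul_mulVec, dotProduct_smul] at h1 h2
  push_cast at h1 h2
  simp only [one_smul, neg_smul, Complex.neg_re] at h1 h2
  unfold expect
  refine ⟨?_, ?_, ?_, ?_⟩ <;> linarith

/-- `spinNN_4x4_U12_bracket` (per-bond part) with the hypothesis taken as the claim node `torusUpper_mbbootE2_4x4_U12_N16`. Zero admits. -/
theorem spinNN_4x4_U12_bracket_of_claim
    (lo : sdp_corr_sector_hub_torus4x4_U12_N16_b4eom_Slo) (up : sdp_corr_sector_hub_torus4x4_U12_N16_b4eom_Sup)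
    (h : torusUpper_mbbootE2_4x4_U12_N16)
    {ψ : Fock (Orb (FermionTorus 2 4))} (hψ : IsGroundState (hamiltonian (fermionTorusGraph 2 4) 1 12) 16 ψ)
    (hψ1 : star ψ ⬝ᵥ ψ = 1) :
    (-0.3348239 : ℝ) ≤ (expect (∑ x : FermionTorus 2 4, ∑ y : FermionTorus 2 4, if (fermionTorusGraph 2 4).Adj x y then fermionSpinDot x y else 0) ψ).re / 64 ∧
    (expect (∑ x : FermionTorus 2 4, ∑ y : FermionTorus 2 4, if (fermionTorusGraph 2 4).Adj x y then fermionSpinDot x y else 0) ψ).re / 64 ≤ -0.2320928 :=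
  (spinNN_4x4_U12_bracket lo up
  (by have := groundEnergyAt_rect_4x4_U12_N16_le_of_claim h; unfold E₀; push_cast; linarith) hψ hψ1).2.2

/-- **Two-sided bracket on the staggered spin structure of the `4×4`, `U = 12`, half-filled ground state** from the rows
`sdp_corr_sector_hub_torus4x4_U12_N16_b4eom_AF{lo,up}` (kit j098962, j098963) only: for every unit `16`-particle ground vector `ψ` of
`hamiltonian (fermionTorusGraph 2 4) 1 12`, given `E₀(16) ≤ u = -205889822849/34359738368` (E2's certified Rayleigh upper), the per-site staggered structure factor
`S(π,π) = ⟨𝓢⟩/16 ∈ [1.3868744, 4.53568]` and `m_s² = ⟨𝓢⟩/256 ∈ [0.0866796, 0.28348]` (exact `[26826052644516372614974435/1208925819614629174706176/16, 87732809415096580000574669/1208925819614629174706176/16]`; decimals rounded outward;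
`𝓢 = stagStructureFour`). Comparison: pub-hubbard has no `U = 12` staggered row; this is the first certified two-sided `S(π,π)` bracket at U = 12. Zero admits. -/
theorem stagStructure_4x4_U12_bracket
    (lo : sdp_corr_sector_hub_torus4x4_U12_N16_b4eom_AFlo) (up : sdp_corr_sector_hub_torus4x4_U12_N16_b4eom_AFup)
    (hu : E₀ 4 4 1 12 16 ≤ -205889822849/34359738368)
    {ψ : Fock (Orb (FermionTorus 2 4))} (hψ : IsGroundState (hamiltonian (fermionTorusGraph 2 4) 1 12) 16 ψ)
    (hψ1 : star ψ ⬝ᵥ ψ = 1) :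
    (1.3868744 : ℝ) ≤ (expect stagStructureFour ψ).re / 16 ∧ (expect stagStructureFour ψ).re / 16 ≤ 4.53568 ∧
    (0.0866796 : ℝ) ≤ (expect stagStructureFour ψ).re / 256 ∧ (expect stagStructureFour ψ).re / 256 ≤ 0.28348 := by
  have hu' : groundEnergyAt (fermionTorusGraph 2 4) 1 12 16 ≤ ((-205889822849/34359738368 : ℚ) : ℝ) := by
    rw [groundEnergyAt_fermionTorusGraph_two]; push_cast; simpa [E₀] using hu
  have hH : hamiltonian (fermionTorusGraph 2 4) 1 12 *ᵥ ψ =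
      ((groundEnergyAt (fermionTorusGraph 2 4) 1 12 16 : ℝ) : ℂ) • ψ := hψ.2.2
  have h1 := lo hu' ψ hψ.1 hψ1 hH
  have h2 := up hu' ψ hψ.1 hψ1 hH
  rw [Matrix.smul_mulVec, dotProduct_smul] at h1 h2
  push_cast at h1 h2
  simp only [one_smul, neg_smul, Complex.neg_re] at h1 h2
  unfold expect
  refine ⟨?_, ?_, ?_, ?_⟩ <;> linarith

/-- `stagStructure_4x4_U12_bracket` with the hypothesis taken as the claim node `torusUpper_mbbootE2_4x4_U12_N16`. Zero admits. -/
theorem stagStructure_4x4_U12_bracket_of_claim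
    (lo : sdp_corr_sector_hub_torus4x4_U12_N16_b4eom_AFlo) (up : sdp_corr_sector_hub_torus4x4_U12_N16_b4eom_AFup)
    (h : torusUpper_mbbootE2_4x4_U12_N16)
    {ψ : Fock (Orb (FermionTorus 2 4))} (hψ : IsGroundState (hamiltonian (fermionTorusGraph 2 4) 1 12) 16 ψ)
    (hψ1 : star ψ ⬝ᵥ ψ = 1) :
    (1.3868744 : ℝ) ≤ (expect stagStructureFour ψ).re / 16 ∧ (expect stagStructureFour ψ).re / 16 ≤ 4.53568 ∧
    (0.0866796 : ℝ) ≤ (expect stagStructureFour ψ).re / 256 ∧ (expect stagStructureFour ψ).re / 256 ≤ 0.28348 :=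
  stagStructure_4x4_U12_bracket lo up
  (by have := groundEnergyAt_rect_4x4_U12_N16_le_of_claim h; unfold E₀; push_cast; linarith) hψ hψ1

end Gen129SectorCorrelatorsU6U12

end Summit.HubbardSuperconductivity.ManyBodyBootstrap.Bounds

end
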